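import Mathlib

/-!
# T5RestrictedProductSplit — the regrouping `G(𝔸) = G_v × G^v` for restricted products

Tier-5 support (seat p3) for the one-line regrouping used in row N2.2.1's [P] proof of
`route/T5-N2-route-3.md` («its v-component is a non-zero element of …», which reads the adelic
group as the product of its `v`-component and the restricted product over the other places) and
listed as prose in `route/T5-SUPPORT-p3.md` §17(b) («restricted tensor products and the regrouping
`G(𝔸) = G_v × G^v`»).

Mathlib's `RestrictedProduct R A 𝓕` (notation `Πʳ i, [R i, A i]` for the cofinite filter) is the
set of `x : Π i, R i` with `x i ∈ A i` for all but finitely many `i`; for a family of groups with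
subgroups `A i` it is a group under the componentwise operations.  This file proves that splitting
off one index `v` is a group isomorphism
`Πʳ i, [G i, A i] ≃* G v × Πʳ j : {j // j ≠ v}, [G j, A j]` (`splitAt`), built on
`Equiv.piSplitAt` and the observation that the cofiniteness condition is insensitive to one
coordinate (`eventually_cofinite_iff_subtype`).

Honest scope: the GROUP-level regrouping only; the restricted TENSOR product of representations
(`ω = ω_v ⊗ ω^v`) and the identification of `G(𝔸)` with a restricted product of the local groups
stay prose.  Uses an L-value-free non-vanishing device: NO (README §8(d)).
-/

namespace Summit.Ventures.HodgeRepro2.T5RestrictedProductSplit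

open scoped RestrictedProduct
open Filter Set

variable {ι : Type*} [DecidableEq ι] (G : ι → Type*) (A : (i : ι) → Set (G i)) (v : ι)

/-- The cofiniteness condition defining a restricted product is insensitive to one coordinate:
`x i ∈ A i` for all but finitely many `i` iff it holds for all but finitely many `i ≠ v`. -/
theorem eventually_cofinite_iff_subtype (x : Π i, G i) :
    (∀ᶠ i in cofinite, x i ∈ A i) ↔ ∀ᶠ j : {j // j ≠ v} in cofinite, x j ∈ A j := by
  simp only [eventually_cofinite]
  constructor
  · intro h
    exact h.preimage Subtype.val_injective.injOn
  · intro h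
    refine ((h.image Subtype.val).insert v).subset ?_
    intro i hi
    by_cases hiv : i = v
    · exact hiv ▸ mem_insert _ _
    · exact mem_insert_of_mem _ ⟨⟨i, hiv⟩, hi, rfl⟩

/-- Splitting off the coordinate `v` of a restricted product, as a bijection:
`x ↦ (x v, (x j)_{j ≠ v})`, inverse built with `Equiv.piSplitAt`. -/
def splitAtEquiv : (Πʳ i, [G i, A i]) ≃ G v × Πʳ j : {j // j ≠ v}, [G j, A j] where
  toFun x := (x v, ⟨fun j => x j, (eventually_cofinite_iff_subtype G A v x).1 x.2⟩)
  invFun p := ⟨(Equiv.piSplitAt v G).symm (p.1, fun j => p.2 j), by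
    rw [eventually_cofinite_iff_subtype G A v]
    refine p.2.2.mono fun j hj => ?_
    rw [Equiv.piSplitAt_symm_apply, dif_neg j.2]
    exact hj⟩
  left_inv x := by
    ext i
    change (Equiv.piSplitAt v G).symm (x v, fun j : {j // j ≠ v} => x j) i = x i
    rw [Equiv.piSplitAt_symm_apply]
    split_ifs with h
    · subst h
      rfl
    · rfl
  right_inv p := by
    refine Prod.ext ?_ (RestrictedProduct.ext _ _ fun j => ?_)
    · change (Equiv.piSplitAt v G).symm (p.1, fun j : {j // j ≠ v} => p.2 j) v = p.1
      rw [Equiv.piSplitAt_symm_apply, dif_pos rfl]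
    · change (Equiv.piSplitAt v G).symm (p.1, fun j : {j // j ≠ v} => p.2 j) j = p.2 j
      rw [Equiv.piSplitAt_symm_apply, dif_neg j.2]

/-- First component of `splitAtEquiv`: the value at `v`. -/
@[simp]
theorem splitAtEquiv_apply_fst (x : Πʳ i, [G i, A i]) : (splitAtEquiv G A v x).1 = x v := rfl

/-- Second component of `splitAtEquiv`: the values at the `j ≠ v`. -/
@[simp]
theorem splitAtEquiv_apply_snd (x : Πʳ i, [G i, A i]) (j : {j // j ≠ v}) :
    (splitAtEquiv G A v x).2 j = x j := rfl

/-- The inverse of `splitAtEquiv` puts the first component at `v`. -/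
@[simp]
theorem splitAtEquiv_symm_apply_self (p : G v × Πʳ j : {j // j ≠ v}, [G j, A j]) :
    (splitAtEquiv G A v).symm p v = p.1 := by
  change (Equiv.piSplitAt v G).symm (p.1, fun j : {j // j ≠ v} => p.2 j) v = p.1
  rw [Equiv.piSplitAt_symm_apply, dif_pos rfl]

/-- The inverse of `splitAtEquiv` puts the second component at the `j ≠ v`. -/
@[simp]
theorem splitAtEquiv_symm_apply_of_ne (p : G v × Πʳ j : {j // j ≠ v}, [G j, A j]) (j : {j // j ≠ v}) :
    (splitAtEquiv G A v).symm p j = p.2 j := by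
  change (Equiv.piSplitAt v G).symm (p.1, fun j : {j // j ≠ v} => p.2 j) j = p.2 j
  rw [Equiv.piSplitAt_symm_apply, dif_neg j.2]

section Group

variable [∀ i, Group (G i)] (B : (i : ι) → Subgroup (G i))

/-- The regrouping `G(𝔸) = G_v × G^v`: for a family of groups `G i` with subgroups `B i`, the
restricted product splits as a group isomorphism
`Πʳ i, [G i, B i] ≃* G v × Πʳ j : {j // j ≠ v}, [G j, B j]`. -/
def splitAt : (Πʳ i, [G i, B i]) ≃* G v × Πʳ j : {j // j ≠ v}, [G j, B j] where
  toEquiv := splitAtEquiv G (fun i => (B i : Set (G i))) v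
  map_mul' x y := by
    refine Prod.ext ?_ (RestrictedProduct.ext _ _ fun j => ?_)
    · exact RestrictedProduct.mul_apply G x y v
    · exact RestrictedProduct.mul_apply G x y j

/-- First component of `splitAt`: the value at `v`. -/
@[simp]
theorem splitAt_apply_fst (x : Πʳ i, [G i, B i]) : (splitAt G v B x).1 = x v := rfl

/-- Second component of `splitAt`: the values at the `j ≠ v`. -/
@[simp]
theorem splitAt_apply_snd (x : Πʳ i, [G i, B i]) (j : {j // j ≠ v}) :
    (splitAt G v B x).2 j = x j := rfl

/-- The inverse of `splitAt` puts the first component at `v`. -/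
@[simp]
theorem splitAt_symm_apply_self (p : G v × Πʳ j : {j // j ≠ v}, [G j, B j]) :
    (splitAt G v B).symm p v = p.1 :=
  splitAtEquiv_symm_apply_self G (fun i => (B i : Set (G i))) v p

/-- The inverse of `splitAt` puts the second component at the `j ≠ v`. -/
@[simp]
theorem splitAt_symm_apply_of_ne (p : G v × Πʳ j : {j // j ≠ v}, [G j, B j]) (j : {j // j ≠ v}) :
    (splitAt G v B).symm p j = p.2 j :=
  splitAtEquiv_symm_apply_of_ne G (fun i => (B i : Set (G i))) v p j

/-- The `v`-component of `splitAt` is multiplicative: evaluation at `v` is a homomorphism. -/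
theorem fst_splitAt_mul (x y : Πʳ i, [G i, B i]) :
    (splitAt G v B (x * y)).1 = (splitAt G v B x).1 * (splitAt G v B y).1 :=
  RestrictedProduct.mul_apply G x y v

end Group

end Summit.Ventures.HodgeRepro2.T5RestrictedProductSplit
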